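import Literature.AnabelianGeometry.EtaleTheta.KummerKernel
import Literature.AnabelianGeometry.AbsoluteAnabelian.AbsTopIII.KummerFaithfulLocalFieldProofs
import Literature.NumberTheory.GaloisRepresentations.LocalFieldPadicProofs
import Summits.ABC.IUTFork.LanaKummer
import HarnessLib

/-!
# L-LANA objects XII bis: the Kummer map `K_v^× → H¹(G_v, Λ)` IS an embedding (LANA §4.2 (b); N13 injectivity DISCHARGED)

Record-only file (D-0012) of the abc-iut cell (seat abc-iut-c312-4, L-LANA level, plan/LLANA-SPEC N9/N13);
TAKES NO SIDE on [IUTchIII] Cor. 3.12. LANA §4.2 (b) p. 26 lists among the objects at a nonarchimedean place: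
"The embedding `K_v^× = (K̄_v^×)^{G_v} ↪ H¹(Π_v, Λ(O^×_v))` by Kummer theory". `LanaKummer.lean` built the map
(`AlgCl.kummerBase K_v := ` L2-t3's `kummerMapFixed` at level `G_v`, over the CONSTRUCTED place datum
`K̄_v = AlgCl K_v`, `G_v = Gal(K̄_v/K_v)`) and left INJECTIVITY as its modelling note (iii) ("classical Kummer
theory (`∩_n (K_v^×)^n = 1`) … NOT proved here"). This file discharges it:

* `AlgCl.unitsEquivInvariants` — **`K_v^× ≃ (K̄_v^×)^{G_v}`** as a group isomorphism (characteristic `0`;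
  the membership statement is gen-0's `AlgCl.mem_unitsInvariants_top_iff`), and `AlgCl.kummerEmbedding` = the
  printed composite `K_v^× = (K̄_v^×)^{G_v} → H¹(G_v, Λ(K̄_v^×))`;
* `AlgCl.kummerBase_injective_of` / `AlgCl.kummerEmbedding_injective_of` — the Kummer map is INJECTIVE as
  soon as `⋂_n (K_v^×)^n = 1`, i.e. under seat abc-iut-L4's presentation-free condition
  `DivisibleElementsTrivial K_vˣ` ([AbsTopIII] Def. 1.5 (a)); the cohomological step is L2-t3's
  `kummerMapFixed_injective_of_iInter_pow_eq_bot` (`KummerKernel.lean`: `κ(a) = 0` iff `a` has a compatible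
  system of `G_v`-invariant roots);
* `AlgCl.padic_kummerBase_injective` — **UNCONDITIONAL at `K_v = ℚ_p`**: `⋂_n (ℚ_p^×)^n = 1` is L4's
  `IsNonarchimedeanLocalField.divisibleElementsTrivial_units` applied through the GalRep trunk's
  `Padic.isNonarchimedeanLocalField_holds` (`ℚ_p` is a nonarchimedean local field in Mathlib's sense).

Why it matters at the L-LANA level: injectivity of the local Kummer maps `κ_t` is exactly the hypothesis `hκ`
under which `LanaEtaAlgorithm.lean` proves `φ_v` injective and "Containment ⟺ Factors" with a UNIQUE
factorisation (§6.2 (g) p. 36 / §9.1 (f) p. 45). For a general `K_v` the condition `DivisibleElementsTrivial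
K_vˣ` holds for every nonarchimedean local field (L4, `KummerFaithfulLocalFieldProofs.lean`, Mathlib's
`IsNonarchimedeanLocalField` presentation); it is kept as an explicit hypothesis here only because `AlgCl K_v`
is built over the NORMED presentation of `K_v` (spectral norm), and is discharged below where both presentations
are available in the tree (`ℚ_p`). [cite: LANA2026Report, §4.2 (b) p. 26, §6.1 p. 31, §6.2 (g) p. 35]
NOT here: the colimit over open `H` (sibling `LanaKummerTower.lean`), `Π_v`-inflation, any judgement.
-/

noncomputable section

namespace Summit.ABC
namespace IUTFork
namespace AlgCl

open Literature.AnabelianGeometry.EtaleTheta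
open Literature.AnabelianGeometry.AbsoluteAnabelian.AbsTopIII (DivisibleElementsTrivial)
open scoped NNReal

section CharZero

variable (K₀ : Type) [NontriviallyNormedField K₀] [CharZero K₀]

/-- An element of `K_v`, mapped into `K̄_v^×`, is `G_v`-invariant. [cite: LANA2026Report, §4.2 (b) p. 26] -/
theorem unitsMap_mem_invariants (x : K₀ˣ) :
    Units.map (algebraMap K₀ (AlgCl K₀) : K₀ →* AlgCl K₀) x ∈
      invariants (A := (AlgCl K₀)ˣ) (⊤ : Subgroup (Gal K₀)) :=
  (mem_unitsInvariants_top_iff K₀ _).mpr ⟨(x : K₀), by simp⟩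

/-- **`K_v^× → (K̄_v^×)^{G_v}`**, `x ↦ x` (the inclusion `K_v ⊆ K̄_v` on units), as a homomorphism.
[cite: LANA2026Report, §4.2 (b) p. 26] -/
def unitsToInvariants : K₀ˣ →* invariants (A := (AlgCl K₀)ˣ) (⊤ : Subgroup (Gal K₀)) where
  toFun x := ⟨Units.map (algebraMap K₀ (AlgCl K₀) : K₀ →* AlgCl K₀) x, unitsMap_mem_invariants K₀ x⟩
  map_one' := Subtype.ext (map_one _)
  map_mul' x y := Subtype.ext (map_mul _ x y)

/-- Underlying element: `unitsToInvariants x = x ∈ K̄_v`. [cite: LANA2026Report, §4.2 (b) p. 26] -/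
@[simp] theorem coe_unitsToInvariants (x : K₀ˣ) :
    (((unitsToInvariants K₀ x : invariants (A := (AlgCl K₀)ˣ) ⊤) : (AlgCl K₀)ˣ) : AlgCl K₀) =
      algebraMap K₀ (AlgCl K₀) x := by
  simp [unitsToInvariants]

/-- `K_v^× → (K̄_v^×)^{G_v}` is a bijection: injective because `K_v → K̄_v` is, surjective because in
characteristic zero the `G_v`-invariants of `K̄_v` are `K_v` (`mem_unitsInvariants_top_iff`).
[cite: LANA2026Report, §4.2 (b) p. 26] -/
theorem unitsToInvariants_bijective : Function.Bijective (unitsToInvariants K₀) := by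
  constructor
  · intro x y h
    have h' := congrArg (fun a : invariants (A := (AlgCl K₀)ˣ) (⊤ : Subgroup (Gal K₀)) =>
      (((a : (AlgCl K₀)ˣ)) : AlgCl K₀)) h
    simp only [coe_unitsToInvariants] at h'
    exact Units.ext ((algebraMap K₀ (AlgCl K₀)).injective h')
  · intro a
    obtain ⟨x, hx⟩ := (mem_unitsInvariants_top_iff K₀ (a : (AlgCl K₀)ˣ)).mp a.2
    have hx0 : x ≠ 0 := by
      rintro rfl
      rw [map_zero] at hx
      exact (a : (AlgCl K₀)ˣ).ne_zero hx.symm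
    refine ⟨Units.mk0 x hx0, Subtype.ext (Units.ext ?_)⟩
    rw [coe_unitsToInvariants, Units.val_mk0, hx]

/-- **"`K_v^× = (K̄_v^×)^{G_v}`"** (§4.2 (b)) as a group isomorphism. [cite: LANA2026Report, §4.2 (b) p. 26] -/
def unitsEquivInvariants : K₀ˣ ≃* invariants (A := (AlgCl K₀)ˣ) (⊤ : Subgroup (Gal K₀)) :=
  MulEquiv.ofBijective (unitsToInvariants K₀) (unitsToInvariants_bijective K₀)

/-- The isomorphism on underlying elements. [cite: LANA2026Report, §4.2 (b) p. 26] -/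
@[simp] theorem coe_unitsEquivInvariants (x : K₀ˣ) :
    (((unitsEquivInvariants K₀ x : invariants (A := (AlgCl K₀)ˣ) ⊤) : (AlgCl K₀)ˣ) : AlgCl K₀) =
      algebraMap K₀ (AlgCl K₀) x :=
  coe_unitsToInvariants K₀ x

/-- **LANA §4.2 (b), second bullet: "the embedding `K_v^× = (K̄_v^×)^{G_v} ↪ H¹(Π_v, Λ(O^×_v))` by Kummer
theory"** — here at the level of `G_v` (print: `Π_v`; the passage `H¹(G_v, –) → H¹(Π_v, –)` is inflation along
`Π_v ↠ G_v`, not typed in this file): the composite of `K_v^× ≃ (K̄_v^×)^{G_v}` with the level-`G_v` Kummer map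
`kummerBase` into `H¹(G_v, Λ(K̄_v^×))` (injectivity: `kummerEmbedding_injective_of`).
[cite: LANA2026Report, §4.2 (b) p. 26] -/
def kummerEmbedding :
    Additive K₀ˣ →+ groupCohomology.H1 (cyclotomeRep (A := (AlgCl K₀)ˣ) (⊤ : Subgroup (Gal K₀))) :=
  (kummerBase K₀).comp (MonoidHom.toAdditive (unitsEquivInvariants K₀).toMonoidHom)

/-- `kummerEmbedding x = kummerBase (x ∈ (K̄_v^×)^{G_v})`. [cite: LANA2026Report, §4.2 (b) p. 26] -/
theorem kummerEmbedding_apply (x : K₀ˣ) :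
    kummerEmbedding K₀ (Additive.ofMul x) = kummerBase K₀ (Additive.ofMul (unitsEquivInvariants K₀ x)) := rfl

/-- **INJECTIVITY of the Kummer map `(K̄_v^×)^{G_v} → H¹(G_v, Λ(K̄_v^×))`** under `⋂_n (K_v^×)^n = 1`
([AbsTopIII] Def. 1.5 (a), `DivisibleElementsTrivial K_vˣ`): a class `κ(a)` vanishes iff `a` has a compatible
system of `G_v`-invariant roots (L2-t3 `KummerKernel`), i.e. roots in `K_v^×` for every `n ≥ 1`, forcing `a = 1`.
Modelling note (iii) of `LanaKummer.lean`, discharged modulo the classical condition.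
[cite: LANA2026Report, §4.2 (b) p. 26, §6.1 p. 31] -/
theorem kummerBase_injective_of (h : DivisibleElementsTrivial K₀ˣ) : Function.Injective (kummerBase K₀) := by
  unfold kummerBase kummerAt
  refine kummerMapFixed_injective_of_iInter_pow_eq_bot (A := (AlgCl K₀)ˣ) ⊤ fun a ha => ?_
  obtain ⟨x, rfl⟩ := (unitsEquivInvariants K₀).surjective a
  have hx : x = 1 := h.eq_one_of_forall_exists_pow x fun n hn => by
    obtain ⟨b, hb⟩ := ha ⟨n, hn⟩
    obtain ⟨y, rfl⟩ := (unitsEquivInvariants K₀).surjective b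
    refine ⟨y, (unitsEquivInvariants K₀).injective ?_⟩
    rw [map_pow]
    exact hb
  rw [hx, map_one]

/-- **The embedding `K_v^× ↪ H¹(G_v, Λ)`** is injective under `⋂_n (K_v^×)^n = 1`.
[cite: LANA2026Report, §4.2 (b) p. 26] -/
theorem kummerEmbedding_injective_of (h : DivisibleElementsTrivial K₀ˣ) :
    Function.Injective (kummerEmbedding K₀) :=
  (kummerBase_injective_of K₀ h).comp
    (fun _ _ hab => Additive.toMul.injective ((unitsEquivInvariants K₀).injective (Additive.ofMul.injective hab)))

/-- Consequently (still under `⋂_n (K_v^×)^n = 1`): `κ(x) = 0 ⟺ x = 1` for `x ∈ K_v^×` — the Kummer class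
detects every nontrivial element of `K_v^×`. [cite: LANA2026Report, §4.2 (b) p. 26] -/
theorem kummerEmbedding_eq_zero_iff_of (h : DivisibleElementsTrivial K₀ˣ) (x : K₀ˣ) :
    kummerEmbedding K₀ (Additive.ofMul x) = 0 ↔ x = 1 := by
  constructor
  · intro h0
    have h1 : Additive.ofMul x = 0 := kummerEmbedding_injective_of K₀ h (by rw [h0, map_zero])
    exact Additive.ofMul.injective h1
  · rintro rfl
    exact map_zero (kummerEmbedding K₀)

end CharZero

/-! ### `K_v = ℚ_p`: no hypothesis left -/

section Padic

variable (p : ℕ) [Fact p.Prime]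

/-- **`⋂_n (ℚ_p^×)^n = 1`**: `ℚ_p` is a nonarchimedean local field in Mathlib's sense (GalRep trunk
`Padic.isNonarchimedeanLocalField_holds`), and every such field satisfies [AbsTopIII] Def. 1.5 (a) for `𝔾_m`
(seat abc-iut-L4, `IsNonarchimedeanLocalField.divisibleElementsTrivial_units`).
[cite: MochizukiAbsTopIII2015, Rmk 1.5.4 (i) p. 33] -/
theorem padic_divisibleElementsTrivial : DivisibleElementsTrivial ℚ_[p]ˣ := by
  haveI : IsNonarchimedeanLocalField ℚ_[p] :=
    Literature.NumberTheory.GaloisRepresentations.Padic.isNonarchimedeanLocalField_holds p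
  exact Literature.AnabelianGeometry.AbsoluteAnabelian.AbsTopIII.IsNonarchimedeanLocalField.divisibleElementsTrivial_units
    ℚ_[p]

/-- **LANA §4.2 (b) at `v | p`, `K_v = ℚ_p`, UNCONDITIONALLY**: the Kummer map
`(ℚ̄_p^×)^{G_{ℚ_p}} → H¹(G_{ℚ_p}, Λ(ℚ̄_p^×))` is injective. [cite: LANA2026Report, §4.2 (b) p. 26] -/
theorem padic_kummerBase_injective : Function.Injective (kummerBase ℚ_[p]) :=
  kummerBase_injective_of ℚ_[p] (padic_divisibleElementsTrivial p)

/-- … and so is the embedding `ℚ_p^× ↪ H¹(G_{ℚ_p}, Λ(ℚ̄_p^×))`. [cite: LANA2026Report, §4.2 (b) p. 26] -/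
theorem padic_kummerEmbedding_injective : Function.Injective (kummerEmbedding ℚ_[p]) :=
  kummerEmbedding_injective_of ℚ_[p] (padic_divisibleElementsTrivial p)

/-- At `ℚ_p`: `κ(x) = 0 ⟺ x = 1` for every `x ∈ ℚ_p^×`. [cite: LANA2026Report, §4.2 (b) p. 26] -/
theorem padic_kummerEmbedding_eq_zero_iff (x : ℚ_[p]ˣ) :
    kummerEmbedding ℚ_[p] (Additive.ofMul x) = 0 ↔ x = 1 :=
  kummerEmbedding_eq_zero_iff_of ℚ_[p] (padic_divisibleElementsTrivial p) x

end Padic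

end AlgCl

end IUTFork

end Summit.ABC

end
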